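import Mathlib
import HarnessLib
import Summits.ValiantsHypothesis.ValiantsHypothesis.Theorems.MonotoneRestorationOrbitRestorationQPSimpleGraphCut
import Literature.ModelTheory.FiniteModelTheory.CkEquivHomCount

/-!
# Route MonotoneRestoration, crux `OrbitRestorationQP` (stmt-18293) — MATRIX-SYMMETRIC POLYNOMIALS ARE BLIND TO THE
# BIPARTITE DOUBLE COVER (a certified remark on the one-sorted / two-sorted gap of `SimpleGraphCut`)

Helper file (`--supports`), def-free.  The finite-model-theory half H₁ of the lossless cut
(`SimpleGraphCut.orbitRestorationQP_iff_simpleGraphCut`, p825758) asks a matrix-symmetric family to be constant on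
`C^k`-classes of SIMPLE GRAPHS (one-sorted), while the registered GAP 2 uses TWO-SORTED hom-indistinguishability.  The
two relations differ already at the level of isomorphism, but in a direction matrix symmetry cannot see:

* `eval_blockDiagonal_eq_eval_antiDiagonal` — for every polynomial `p` in the entries of a `(ι ⊕ ι) × (ι ⊕ ι)` matrix
  that is invariant under independent row and column permutations, and every block `A : ι × ι → R`,
  `p [[A, 0], [0, A]] = p [[0, A], [A, 0]]` (the column permutation `Sum.swap` carries one to the other);
* `eval_indicator_sum_eq_eval_indicator_doubleCover` — hence for every simple graph `G` a matrix-symmetric `p` takes the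
  same value at the adjacency matrix of the disjoint union `G ⊔ G` and at that of the BIPARTITE DOUBLE COVER `G × K₂`
  (whose two-sorted structures are isomorphic: both are `2·(G × K₂)`), although `G ⊔ G` and `G × K₂` are in general not
  even `C³`-equivalent (`G = K₃`: `2K₃` has triangles, `C₆` has none).  So no matrix-symmetric family detects odd
  cycles / bipartiteness, and a refuter's separating pair `X ≡^{C^k} Y` for H₁ must have non-isomorphic double covers
  as two-sorted structures — the registered two-sorted currency loses nothing at the isomorphism level; what it may lose
  is only in the small-`k` logic (recorded in SIMPLE-GRAPH-CUT-g3.md);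
* `not_ckEquiv_three_sum_doubleCover` — the example `G = K₃` certified: `K₃ ⊔ K₃ ≢^{C³} C₆` (Dvořák, triangle test
  graph: `nonempty_hom_top_sum`, `isEmpty_hom_top_doubleCover`).

Honest label: certified remark; nothing closed. [folklore]
-/

-- `Summit.ValiantsHypothesis.ValiantsHypothesis.…` is the tree's mandated namespace (Sub = Summit).
set_option linter.dupNamespace false

noncomputable section

namespace Summit.ValiantsHypothesis.ValiantsHypothesis.Theorems

namespace SimpleGraphCut

open MvPolynomial

variable {ι R : Type*} [CommSemiring R]

/-- **Block-diagonal versus anti-diagonal.**  A polynomial in the entries of a `(ι ⊕ ι) × (ι ⊕ ι)` matrix invariant under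
independent row and column permutations takes the same value at `[[A, 0], [0, A]]` and at `[[0, A], [A, 0]]`: the column
permutation `Sum.swap` maps one matrix to the other. [folklore] -/
theorem eval_blockDiagonal_eq_eval_antiDiagonal (p : MvPolynomial ((ι ⊕ ι) × (ι ⊕ ι)) R)
    (hp : ∀ σ τ : Equiv.Perm (ι ⊕ ι), rename (fun uv : (ι ⊕ ι) × (ι ⊕ ι) => (σ uv.1, τ uv.2)) p = p)
    (A : ι × ι → R) :
    MvPolynomial.eval (fun uv : (ι ⊕ ι) × (ι ⊕ ι) => match uv with
        | (Sum.inl i, Sum.inl j) => A (i, j)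
        | (Sum.inr i, Sum.inr j) => A (i, j)
        | (Sum.inl _, Sum.inr _) => 0
        | (Sum.inr _, Sum.inl _) => 0) p =
      MvPolynomial.eval (fun uv : (ι ⊕ ι) × (ι ⊕ ι) => match uv with
        | (Sum.inl i, Sum.inr j) => A (i, j)
        | (Sum.inr i, Sum.inl j) => A (i, j)
        | (Sum.inl _, Sum.inl _) => 0
        | (Sum.inr _, Sum.inr _) => 0) p := by
  conv_rhs => rw [← hp 1 (Equiv.sumComm ι ι)]
  rw [eval_rename]
  refine congrArg (fun F : (ι ⊕ ι) × (ι ⊕ ι) → R => MvPolynomial.eval F p) ?_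
  funext uv
  rcases uv with ⟨u | u, v | v⟩ <;> rfl

/-- **Matrix-symmetric polynomials are blind to the bipartite double cover.**  For a simple graph `G` on `ι` and a
matrix-symmetric `p` on `(ι ⊕ ι) × (ι ⊕ ι)` matrices, `p` takes the same value at the adjacency matrix of the disjoint
union `G ⊔ G` (`SimpleGraph.sum`, Mathlib `G ⊕g G`) and at that of the bipartite double cover `G × K₂` (adjacency
`inl i ~ inr j ↔ G.Adj i j`).  E.g. `G = K₃`: `2K₃` versus `C₆` — one `S₆ × S₆`-orbit of `0/1` matrices, two `C³`-classes
of graphs. [folklore] -/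
theorem eval_indicator_sum_eq_eval_indicator_doubleCover (G : SimpleGraph ι)
    (p : MvPolynomial ((ι ⊕ ι) × (ι ⊕ ι)) R)
    (hp : ∀ σ τ : Equiv.Perm (ι ⊕ ι), rename (fun uv : (ι ⊕ ι) × (ι ⊕ ι) => (σ uv.1, τ uv.2)) p = p) :
    MvPolynomial.eval (Set.indicator {uv : (ι ⊕ ι) × (ι ⊕ ι) | (G ⊕g G).Adj uv.1 uv.2} 1) p =
      MvPolynomial.eval (Set.indicator {uv : (ι ⊕ ι) × (ι ⊕ ι) |
        match uv with
        | (Sum.inl i, Sum.inr j) => G.Adj i j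
        | (Sum.inr i, Sum.inl j) => G.Adj i j
        | (Sum.inl _, Sum.inl _) => False
        | (Sum.inr _, Sum.inr _) => False} 1) p := by
  classical
  have key := eval_blockDiagonal_eq_eval_antiDiagonal p hp
    (Set.indicator {ij : ι × ι | G.Adj ij.1 ij.2} (1 : ι × ι → R))
  have h1 : (Set.indicator {uv : (ι ⊕ ι) × (ι ⊕ ι) | (G ⊕g G).Adj uv.1 uv.2} (1 : (ι ⊕ ι) × (ι ⊕ ι) → R)) =
      fun uv : (ι ⊕ ι) × (ι ⊕ ι) => match uv with
        | (Sum.inl i, Sum.inl j) => Set.indicator {ij : ι × ι | G.Adj ij.1 ij.2} (1 : ι × ι → R) (i, j)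
        | (Sum.inr i, Sum.inr j) => Set.indicator {ij : ι × ι | G.Adj ij.1 ij.2} (1 : ι × ι → R) (i, j)
        | (Sum.inl _, Sum.inr _) => 0
        | (Sum.inr _, Sum.inl _) => 0 := by
    funext uv
    rcases uv with ⟨u | u, v | v⟩ <;> simp [Set.indicator]
  have h2 : (Set.indicator {uv : (ι ⊕ ι) × (ι ⊕ ι) |
        match uv with
        | (Sum.inl i, Sum.inr j) => G.Adj i j
        | (Sum.inr i, Sum.inl j) => G.Adj i j
        | (Sum.inl _, Sum.inl _) => False
        | (Sum.inr _, Sum.inr _) => False} (1 : (ι ⊕ ι) × (ι ⊕ ι) → R)) =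
      fun uv : (ι ⊕ ι) × (ι ⊕ ι) => match uv with
        | (Sum.inl i, Sum.inr j) => Set.indicator {ij : ι × ι | G.Adj ij.1 ij.2} (1 : ι × ι → R) (i, j)
        | (Sum.inr i, Sum.inl j) => Set.indicator {ij : ι × ι | G.Adj ij.1 ij.2} (1 : ι × ι → R) (i, j)
        | (Sum.inl _, Sum.inl _) => 0
        | (Sum.inr _, Sum.inr _) => 0 := by
    funext uv
    rcases uv with ⟨u | u, v | v⟩ <;> simp [Set.indicator]
  rw [h1, h2]
  exact key

/-! ### The example `G = K₃`: one `S × S`-orbit of matrices, two `C³`-classes of graphs -/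

/-- The triangle has a homomorphism into `K₃ ⊔ K₃` (the left inclusion). [folklore] -/
theorem nonempty_hom_top_sum :
    Nonempty ((⊤ : SimpleGraph (Fin 3)) →g ((⊤ : SimpleGraph (Fin 3)) ⊕g (⊤ : SimpleGraph (Fin 3)))) :=
  ⟨{ toFun := Sum.inl
     map_rel' := fun h => (SimpleGraph.sum_adj_inl).2 h }⟩

/-- The triangle has NO homomorphism into the bipartite double cover of `K₃` (the hexagon `C₆`): the two sides
would `2`-colour the triangle. [folklore] -/
theorem isEmpty_hom_top_doubleCover :
    IsEmpty ((⊤ : SimpleGraph (Fin 3)) →g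
      SimpleGraph.fromRel (fun u v : Fin 3 ⊕ Fin 3 => ∃ i j : Fin 3, (⊤ : SimpleGraph (Fin 3)).Adj i j ∧
        u = Sum.inl i ∧ v = Sum.inr j)) := by
  refine ⟨fun g => ?_⟩
  -- the side of `g x` is a proper 2-colouring of the triangle
  have hside : ∀ a b : Fin 3, a ≠ b → (g a).isLeft ≠ (g b).isLeft := by
    intro a b hab h
    have hadj := g.map_rel ((SimpleGraph.top_adj a b).2 hab)
    rw [SimpleGraph.fromRel_adj] at hadj
    obtain ⟨-, ⟨i, j, -, hi, hj⟩ | ⟨i, j, -, hi, hj⟩⟩ := hadj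
    · rw [hi, hj] at h; simp at h
    · rw [hi, hj] at h; simp at h
  have h01 := hside 0 1 (by decide)
  have h02 := hside 0 2 (by decide)
  have h12 := hside 1 2 (by decide)
  rcases h0 : (g 0).isLeft <;> rcases h1 : (g 1).isLeft <;> rcases h2 : (g 2).isLeft <;> simp_all

/-- **`K₃ ⊔ K₃` and `C₆` (the double cover of `K₃`) are NOT `C³`-equivalent** — Dvořák's theorem (tree,
`Dvorak2010.card_hom_eq_of_ckEquiv`) with the triangle as test graph (one bag of size `3`): `6 ≠ 0` homomorphisms.
Together with `eval_indicator_sum_eq_eval_indicator_doubleCover` (their adjacency matrices are one `S × S`-orbit):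
the one-sorted relation of H₁ is strictly finer than two-sorted isomorphism on pairs, invisibly to matrix-symmetric
polynomials. [cite: Dvorak2010, Thm 6] -/
theorem not_ckEquiv_three_sum_doubleCover :
    ¬ Literature.ModelTheory.FiniteModelTheory.CkEquiv 3
        ((⊤ : SimpleGraph (Fin 3)) ⊕g (⊤ : SimpleGraph (Fin 3)))
        (SimpleGraph.fromRel (fun u v : Fin 3 ⊕ Fin 3 => ∃ i j : Fin 3, (⊤ : SimpleGraph (Fin 3)).Adj i j ∧
          u = Sum.inl i ∧ v = Sum.inr j)) := by
  classical
  intro h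
  have hcard := Literature.ModelTheory.FiniteModelTheory.Dvorak2010.card_hom_eq_of_ckEquiv
    (F := (⊤ : SimpleGraph (Fin 3))) (by norm_num) h
    (Literature.Combinatorics.SimpleGraph.TreeDecomposition.trivial (⊤ : SimpleGraph (Fin 3)))
    (fun t => by simp [Literature.Combinatorics.SimpleGraph.TreeDecomposition.trivial])
  have h0 : Nat.card ((⊤ : SimpleGraph (Fin 3)) →g
      SimpleGraph.fromRel (fun u v : Fin 3 ⊕ Fin 3 => ∃ i j : Fin 3, (⊤ : SimpleGraph (Fin 3)).Adj i j ∧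
        u = Sum.inl i ∧ v = Sum.inr j)) = 0 :=
    @Nat.card_of_isEmpty _ isEmpty_hom_top_doubleCover
  have hpos : Nat.card ((⊤ : SimpleGraph (Fin 3)) →g ((⊤ : SimpleGraph (Fin 3)) ⊕g (⊤ : SimpleGraph (Fin 3)))) ≠ 0 := by
    haveI := nonempty_hom_top_sum
    haveI : Finite ((⊤ : SimpleGraph (Fin 3)) →g ((⊤ : SimpleGraph (Fin 3)) ⊕g (⊤ : SimpleGraph (Fin 3)))) :=
      Finite.of_injective (fun g => g.toFun) (fun g₁ g₂ h => RelHom.ext fun x => congrFun h x)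
    exact Nat.card_pos.ne'
  exact hpos (hcard.trans h0)

end SimpleGraphCut

end Summit.ValiantsHypothesis.ValiantsHypothesis.Theorems

end
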